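import Summits.HodgeConjecture.HodgeConjecture.Theorems.R90S4StableClassCartanType      -- ★ p863391 (this seat, part 1): `exists_isConj_cmTorus_of_isStablyConjGAt`, `IsStablyConjGAt`, `hyperbolicSet`, `Gqs`
import Summits.HodgeConjecture.HodgeConjecture.Theorems.F0P3cStCharTSVanDijkWeylSymm       -- ★ `exists_weylElt` (`w₀ ∈ U(Φ₃)(L⁺_v)` with matrix `Φ₃`)
import Literature.NumberTheory.Automorphic.CMBorelWeylTorusConjugate                     -- ★ `weylLong_mul_glDiagonal_mul_inv` (`w₀ diag(d) w₀⁻¹ = diag(d ∘ rev)`), `weylConj_mem_torusU`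
import Literature.NumberTheory.Rogawski1990.LocalTransfer                                 -- ★ `stableOrbitalIntegralRel`, `isRegularElt_of_isConj`, `isRegularElt_iff`
import HarnessLib

/-!
# R90-TF · S4 «Ch. 13.1–2», brick (B2-S)(S2-M), part 2 — ON THE SPLIT CARTAN, STABLE CLASS = CLASS: two regular elements of `M` conjugate in `GL₃` are
# equal or swapped by the Weyl reflection; hence a regular hyperbolic element's stable class is its conjugacy class and `Φ^{st}(γ, f) = Φ(γ, f)` there
# (Rogawski 1990, §3.6 pp. 28–31: the Cartan of type (0) has `𝔇(M∕F) = 1`; §4.1 (4.1.1) p. 39; §12.5 p. 182)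

Cell `hodgecm-mathlib`, crux H413 (`stmt-HodgeConjecture-24833`, lane `--supports … --as helper`), route of record `HCCMUnconditional` (no route verbs;
count-neutral).  Programme R90-TF, section S4, dealer K2E2-plan (g7): DEALT BY NAME «(S2-M) part 2 YOURS next» (S4-R18 token (4), `R90/STATUS.md` 2026-09-05T00:03:02Z);
seat K2E3-p12 (g10).  Sequel of ★ p863391 `R90S4StableClassCartanType` (part 1: a stable conjugate of a regular element of `M` is `U(Φ₃)`-conjugate INTO `M`).  THEOREMS ONLY —
no `def`, no instance, no notation, no `sorry`; ★-only imports.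

## THE MATHEMATICS
`G_v = U(Φ₃)(L⁺_v)` at a NON-SPLIT `v` (one place `w ∣ v`, `E_w = L_w` a field, `σ` its conjugation over `L⁺_v`); `M = {d(d₀, d₁, d₂)}` the diagonal Cartan, with the torus
relations `σ(d_{2−i}) d_i = 1` (★ `glDiagonal_mem_unitaryGroupOfForm_antidiagonal_iff`), i.e. `d₂ = σ(d₀)⁻¹`, `d₁ σ(d₁) = 1`.  Let `t = d(d)`, `t′ = d(d′) ∈ M` with `t` REGULAR
(separable characteristic polynomial) and `t, t′` conjugate in `GL₃(E_w)`.  Then `∏ (X − dᵢ) = ∏ (X − d′ᵢ)` (Mathlib `charpoly_units_conj`, `charpoly_diagonal`), so every `d′ᵢ` is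
some `dⱼ` (read in the field `L_w`), and the `dᵢ` are pairwise distinct (`Separable.injective_of_prod_X_sub_C`).  The middle entry is rigid: `d′₁ = d₀` would give
`σ(d₀) d₀ = 1 = σ(d₀) d₂`, i.e. `d₀ = d₂`; `d′₁ = d₂` likewise; so `d′₁ = d₁`.  Then `d′₀ ∈ {d₀, d₂}` and the relation `d′₂ = σ(d′₀)⁻¹` forces `d′ = d` or `d′ = d ∘ rev`, i.e.
`t′ = t` or `t′ = w₀ t w₀⁻¹` for the Weyl element `w₀ = Φ₃ ∈ G_v` (★ `weylLong_mul_glDiagonal_mul_inv`).  With part 1 this gives: for `t ∈ M` regular, «`γ′` stably conjugate to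
`t`» ⟺ «`γ′` conjugate to `t` in `G_v`» — `𝔇(M∕F) = 1`, the type-(0) row of §3.6 — and for every hyperbolic regular `γ` (★ `hyperbolicSet`) the stable orbital integral
★ `stableOrbitalIntegralRel (IsStablyConjGAt …) mG f γ` (the `finsum` over the classes in the stable class) has the single term `Φ(γ, f) = classOrbitalIntegral mG f ⟦γ⟧`:
the `M`-summand of the plain Weyl measure ★ p863297 passes UNCHANGED into ★ p862981's `IsStableWeylMeasure` (census (B2-S): the elliptic summands wait for (S1)).

## CONTENTS (`v` non-split throughout)
* §1 `eq_or_eq_weylConj_of_isConj_of_mem_cmTorus` — the dichotomy `t′ = t ∨ t′ = w₀ t w₀⁻¹`; `isConj_of_isConj_val_of_mem_cmTorus` — hence `t ∼_{G_v} t′`.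
* §2 `isConj_of_isStablyConjGAt_of_mem_cmTorus`, `isStablyConjGAt_iff_isConj_of_mem_cmTorus` (on `M^{reg}`: stable class = class), `isStablyConjGAt_iff_isConj_of_mem_hyperbolicSet`
  (same on the hyperbolic regular set), `stableOrbitalIntegralRel_eq_classOrbitalIntegral_of_mem_hyperbolicSet` (`Φ^{st} = Φ` there).

HONEST LABEL: HC_CM is proved only modulo the 7 printed citations (2 remaining named inputs: hLiu418 = stmt-HodgeConjecture-24832, h413 = stmt-HodgeConjecture-24833) until rung 0
closes.  Discharges the `M`-part of the stable regrouping (B2-S) only; (W-NP) ∕ (1D-CT)_ns OPEN.  REL ≠ ★ ≠ BUILT.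

## References
* [Rogawski1990] J. D. Rogawski, *Automorphic Representations of Unitary Groups in Three Variables*, Ann. of Math. Stud. 123 (1990), §1.10 p. 9, §3.1 p. 19, §3.6 pp. 28–31
  (Cartan subgroups of `U(3)`, `𝔇(T∕F)`), §4.1 (4.1.1) p. 39, §12.5 p. 182.
-/

set_option autoImplicit false
set_option linter.dupNamespace false

noncomputable section

open NumberField IsDedekindDomain Polynomial
open scoped Matrix MatrixGroups
open Literature.NumberTheory.Automorphic Literature.NumberTheory.Automorphic.UnitaryGroup Literature.NumberTheory.Rogawski1990
open Summit.HodgeConjecture.HodgeConjecture.Cruxes.H413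

namespace Summit.HodgeConjecture.HodgeConjecture.R90.S4

section NonSplit

variable (L : Type) [Field L] [NumberField L] [IsCMField L] (v : HeightOneSpectrum (𝓞 ↥(maximalRealSubfield L)))

/-! ## §1 Two regular elements of `M` conjugate in `GL₃` are equal or Weyl-swapped -/

variable {L v} in
/-- **THE IN-TORUS DICHOTOMY.**  `v` non-split; `w₀ ∈ U(Φ₃)(L⁺_v)` with matrix `Φ₃` (★ `exists_weylElt`); `t, t′ ∈ M` with `t` regular and `t, t′` conjugate in `GL₃(L ⊗ L⁺_v)`.
Then `t′ = t` or `t′ = w₀ t w₀⁻¹`.  (Write `t = d(d)`, `t′ = d(d′)`: equal characteristic polynomials `∏ (X − dᵢ)` make every `d′ᵢ` some `dⱼ` and the `dᵢ` distinct; the torus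
relations `σ(d_{2−i}) dᵢ = 1` pin `d′₁ = d₁` and then `d′ ∈ {d, d ∘ rev}`; `d ∘ rev` is conjugation by `w₀`, ★ `weylLong_mul_glDiagonal_mul_inv`.)
[cite: Rogawski1990, §3.6 pp. 28–31; §1.10 p. 9] -/
theorem eq_or_eq_weylConj_of_isConj_of_mem_cmTorus (hns : ∀ w : PlacesOver L v, IsCMField.complexConj L • w.1 = w.1)
    (w₀ : ↥(unitaryGroupOfForm (conjLocal L (IsCMField.complexConj L) v) (cmLocalForm L 3 v)))
    (hw₀ : Units.val (w₀ : GL (Fin 3) (LocalRing L v)) = cmLocalForm L 3 v)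
    {t t' : ↥(cmBorelTriple L 3 v).M}
    (hreg : IsRegularElt ((t : ↥(unitaryGroupOfForm (conjLocal L (IsCMField.complexConj L) v) (cmLocalForm L 3 v))) : GL (Fin 3) (LocalRing L v)))
    (h : IsConj ((t : ↥(unitaryGroupOfForm (conjLocal L (IsCMField.complexConj L) v) (cmLocalForm L 3 v))) : GL (Fin 3) (LocalRing L v))
      ((t' : ↥(unitaryGroupOfForm (conjLocal L (IsCMField.complexConj L) v) (cmLocalForm L 3 v))) : GL (Fin 3) (LocalRing L v))) :
    (t' : ↥(unitaryGroupOfForm (conjLocal L (IsCMField.complexConj L) v) (cmLocalForm L 3 v))) = t ∨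
      (t' : ↥(unitaryGroupOfForm (conjLocal L (IsCMField.complexConj L) v) (cmLocalForm L 3 v))) =
        w₀ * (t : ↥(unitaryGroupOfForm (conjLocal L (IsCMField.complexConj L) v) (cmLocalForm L 3 v))) * w₀⁻¹ := by
  classical
  -- ### the one place `w ∣ v` and the field `L_w`
  obtain ⟨w⟩ := (inferInstance : Nonempty (PlacesOver L v))
  haveI : Subsingleton (PlacesOver L v) := PlacesOver.subsingleton_of_smul_eq (IsCMField.complexConj L) (IsCMField.complexConj_ne_one L) w (hns w)
  let φ : LocalRing L v →+* w.1.adicCompletion L := Pi.evalRingHom (fun w' : PlacesOver L v => w'.1.adicCompletion L) w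
  have hφ : ∀ x y : LocalRing L v, φ x = φ y → x = y := by
    intro x y hxy
    funext w'
    rw [Subsingleton.elim w' w]
    exact hxy
  -- ### the diagonals `d`, `d′` and their torus relations
  obtain ⟨d, hd⟩ := (mem_torusU_iff _).1 t.2
  obtain ⟨d', hd'⟩ := (mem_torusU_iff _).1 t'.2
  have hrel : ∀ i : Fin 3, conjLocal L (IsCMField.complexConj L) v (d (Fin.rev i) : LocalRing L v) * (d i : LocalRing L v) = 1 := by
    have hm := (t : ↥(unitaryGroupOfForm (conjLocal L (IsCMField.complexConj L) v) (cmLocalForm L 3 v))).2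
    rw [← hd, cmLocalForm_eq_over L 3 v, glDiagonal_mem_unitaryGroupOfForm_antidiagonal_iff] at hm
    exact hm
  have hrel' : ∀ i : Fin 3, conjLocal L (IsCMField.complexConj L) v (d' (Fin.rev i) : LocalRing L v) * (d' i : LocalRing L v) = 1 := by
    have hm := (t' : ↥(unitaryGroupOfForm (conjLocal L (IsCMField.complexConj L) v) (cmLocalForm L 3 v))).2
    rw [← hd', cmLocalForm_eq_over L 3 v, glDiagonal_mem_unitaryGroupOfForm_antidiagonal_iff] at hm
    exact hm
  have hrev0 : Fin.rev (0 : Fin 3) = 2 := by decide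
  have hrev1 : Fin.rev (1 : Fin 3) = 1 := by decide
  have hrev2 : Fin.rev (2 : Fin 3) = 0 := by decide
  -- `σ(d₂) d₀ = 1`, `σ(d₁) d₁ = 1`, `σ(d₀) d₂ = 1` and the same for `d′`
  have r0 : conjLocal L (IsCMField.complexConj L) v (d 2 : LocalRing L v) * (d 0 : LocalRing L v) = 1 := by
    have := hrel 0; rwa [hrev0] at this
  have r1 : conjLocal L (IsCMField.complexConj L) v (d 1 : LocalRing L v) * (d 1 : LocalRing L v) = 1 := hrel 1
  have r2 : conjLocal L (IsCMField.complexConj L) v (d 0 : LocalRing L v) * (d 2 : LocalRing L v) = 1 := by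
    have := hrel 2; rwa [hrev2] at this
  have r1' : conjLocal L (IsCMField.complexConj L) v (d' 1 : LocalRing L v) * (d' 1 : LocalRing L v) = 1 := hrel' 1
  have r2' : conjLocal L (IsCMField.complexConj L) v (d' 0 : LocalRing L v) * (d' 2 : LocalRing L v) = 1 := by
    have := hrel' 2; rwa [hrev2] at this
  -- cancellation of the unit `σ(u)`
  have hcancel : ∀ (u : (LocalRing L v)ˣ) (x y : LocalRing L v),
      conjLocal L (IsCMField.complexConj L) v (u : LocalRing L v) * x = 1 →
        conjLocal L (IsCMField.complexConj L) v (u : LocalRing L v) * y = 1 → x = y := by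
    intro u x y hx hy
    have hu : IsUnit (conjLocal L (IsCMField.complexConj L) v (u : LocalRing L v)) := u.isUnit.map _
    exact hu.mul_right_injective (hx.trans hy.symm)
  -- ### equal characteristic polynomials
  have hcp : (∏ i : Fin 3, (X - C (d' i : LocalRing L v))) = ∏ i : Fin 3, (X - C (d i : LocalRing L v)) := by
    obtain ⟨x, hx⟩ := isConj_iff.mp h
    have h1 : (((t' : ↥(unitaryGroupOfForm (conjLocal L (IsCMField.complexConj L) v) (cmLocalForm L 3 v))) : GL (Fin 3) (LocalRing L v)) :
        Matrix (Fin 3) (Fin 3) (LocalRing L v)).charpoly =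
        (((t : ↥(unitaryGroupOfForm (conjLocal L (IsCMField.complexConj L) v) (cmLocalForm L 3 v))) : GL (Fin 3) (LocalRing L v)) :
          Matrix (Fin 3) (Fin 3) (LocalRing L v)).charpoly := by
      rw [← hx, Units.val_mul, Units.val_mul, Matrix.coe_units_inv, Matrix.charpoly_units_conj]
    rw [← hd, ← hd', coe_glDiagonal, coe_glDiagonal, Matrix.charpoly_diagonal, Matrix.charpoly_diagonal] at h1
    exact h1
  -- ### at the place `w`: distinct roots, and every `d′ᵢ` is some `dⱼ`
  have hmapd : (∏ i : Fin 3, (X - C (d i : LocalRing L v))).map φ = ∏ i : Fin 3, (X - C (φ (d i : LocalRing L v))) := by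
    rw [Polynomial.map_prod]
    refine Finset.prod_congr rfl fun i _ => ?_
    rw [Polynomial.map_sub, Polynomial.map_X, Polynomial.map_C]
  have hmapd' : (∏ i : Fin 3, (X - C (d' i : LocalRing L v))).map φ = ∏ i : Fin 3, (X - C (φ (d' i : LocalRing L v))) := by
    rw [Polynomial.map_prod]
    refine Finset.prod_congr rfl fun i _ => ?_
    rw [Polynomial.map_sub, Polynomial.map_X, Polynomial.map_C]
  have hsep : (∏ i : Fin 3, (X - C (φ (d i : LocalRing L v)))).Separable := by
    have h0 := hreg
    rw [isRegularElt_iff, ← hd, coe_glDiagonal, Matrix.charpoly_diagonal] at h0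
    rw [← hmapd]
    exact h0.map
  have hinj : Function.Injective fun i : Fin 3 => φ (d i : LocalRing L v) := hsep.injective_of_prod_X_sub_C
  have hinjd : ∀ i j : Fin 3, (d i : LocalRing L v) = d j → i = j := fun i j hij => hinj (congrArg φ hij)
  have hsep' : (∏ i : Fin 3, (X - C (φ (d' i : LocalRing L v)))).Separable := by
    rw [← hmapd', hcp, hmapd]; exact hsep
  have hinj' : Function.Injective fun i : Fin 3 => φ (d' i : LocalRing L v) := hsep'.injective_of_prod_X_sub_C
  have hinjd' : ∀ i j : Fin 3, (d' i : LocalRing L v) = d' j → i = j := fun i j hij => hinj' (congrArg φ hij)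
  have hroot : ∀ i : Fin 3, ∃ j : Fin 3, (d' i : LocalRing L v) = d j := by
    intro i
    have hev : Polynomial.eval (φ (d' i : LocalRing L v)) (∏ j : Fin 3, (X - C (φ (d j : LocalRing L v)))) = 0 := by
      rw [← hmapd, ← hcp, hmapd', Polynomial.eval_prod]
      exact Finset.prod_eq_zero (Finset.mem_univ i) (by rw [Polynomial.eval_sub, Polynomial.eval_X, Polynomial.eval_C, sub_self])
    rw [Polynomial.eval_prod, Finset.prod_eq_zero_iff] at hev
    obtain ⟨j, -, hj⟩ := hev
    rw [Polynomial.eval_sub, Polynomial.eval_X, Polynomial.eval_C, sub_eq_zero] at hj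
    exact ⟨j, hφ _ _ hj⟩
  -- ### the middle entry is rigid: `d′₁ = d₁`
  have hmid : (d' 1 : LocalRing L v) = d 1 := by
    obtain ⟨j, hj⟩ := hroot 1
    fin_cases j
    · -- `d′₁ = d₀`: then `σ(d₀) d₀ = 1 = σ(d₀) d₂`, so `d₀ = d₂`
      exfalso
      have h10 : conjLocal L (IsCMField.complexConj L) v (d 0 : LocalRing L v) * (d 0 : LocalRing L v) = 1 := by
        have := r1'; simp only [hj] at this; exact this
      exact absurd (hinjd 0 2 (hcancel (d 0) _ _ h10 r2)) (by decide)
    · exact hj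
    · -- `d′₁ = d₂`: then `σ(d₂) d₂ = 1 = σ(d₂) d₀`, so `d₂ = d₀`
      exfalso
      have h12 : conjLocal L (IsCMField.complexConj L) v (d 2 : LocalRing L v) * (d 2 : LocalRing L v) = 1 := by
        have := r1'; simp only [hj] at this; exact this
      exact absurd (hinjd 2 0 (hcancel (d 2) _ _ h12 r0)) (by decide)
  -- ### the first entry decides: `d′ = d` or `d′ = d ∘ rev`
  obtain ⟨j, hj⟩ := hroot 0
  fin_cases j
  · -- `d′₀ = d₀` ⇒ `d′₂ = d₂` ⇒ `t′ = t`
    left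
    have h2 : (d' 2 : LocalRing L v) = d 2 := by
      have h := r2'; simp only [hj] at h
      exact hcancel (d 0) _ _ h r2
    have hdd : d' = d := by
      funext i
      fin_cases i
      · show d' 0 = d 0
        exact Units.ext hj
      · show d' 1 = d 1
        exact Units.ext hmid
      · show d' 2 = d 2
        exact Units.ext h2
    apply Subtype.ext
    rw [← hd', ← hd, hdd]
  · -- `d′₀ = d₁ = d′₁` contradicts the distinctness of the `d′ᵢ`
    exfalso
    simp only at hj
    exact absurd (hinjd' 0 1 (hj.trans hmid.symm)) (by decide)
  · -- `d′₀ = d₂` ⇒ `d′₂ = d₀` ⇒ `d′ = d ∘ rev` ⇒ `t′ = w₀ t w₀⁻¹`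
    right
    simp only at hj
    have h2 : (d' 2 : LocalRing L v) = d 0 := by
      have h := r2'; simp only [hj] at h
      exact hcancel (d 2) _ _ h r0
    have hdd : d' = fun i => d i.rev := by
      funext i
      fin_cases i
      · show d' 0 = d (Fin.rev 0)
        rw [hrev0]; exact Units.ext hj
      · show d' 1 = d (Fin.rev 1)
        rw [hrev1]; exact Units.ext hmid
      · show d' 2 = d (Fin.rev 2)
        rw [hrev2]; exact Units.ext h2
    apply Subtype.ext
    rw [Subgroup.coe_mul, Subgroup.coe_mul, Subgroup.coe_inv, ← hd', ← hd, hdd]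
    exact (weylLong_mul_glDiagonal_mul_inv (conjLocal L (IsCMField.complexConj L) v) (cmLocalForm_eq_over L 3 v) w₀ hw₀ d).symm

variable {L v} in
/-- **Two regular elements of `M` conjugate in `GL₃(L ⊗ L⁺_v)` are conjugate in `U(Φ₃)(L⁺_v)`** (`v` non-split) — by §1 they are equal or conjugate by the Weyl element
`w₀ ∈ U(Φ₃)(L⁺_v)` (★ `exists_weylElt`). [cite: Rogawski1990, §3.6 pp. 28–31] -/
theorem isConj_of_isConj_val_of_mem_cmTorus (hns : ∀ w : PlacesOver L v, IsCMField.complexConj L • w.1 = w.1)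
    {t t' : ↥(cmBorelTriple L 3 v).M}
    (hreg : IsRegularElt ((t : ↥(unitaryGroupOfForm (conjLocal L (IsCMField.complexConj L) v) (cmLocalForm L 3 v))) : GL (Fin 3) (LocalRing L v)))
    (h : IsConj ((t : ↥(unitaryGroupOfForm (conjLocal L (IsCMField.complexConj L) v) (cmLocalForm L 3 v))) : GL (Fin 3) (LocalRing L v))
      ((t' : ↥(unitaryGroupOfForm (conjLocal L (IsCMField.complexConj L) v) (cmLocalForm L 3 v))) : GL (Fin 3) (LocalRing L v))) :
    IsConj (t : ↥(unitaryGroupOfForm (conjLocal L (IsCMField.complexConj L) v) (cmLocalForm L 3 v)))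
      (t' : ↥(unitaryGroupOfForm (conjLocal L (IsCMField.complexConj L) v) (cmLocalForm L 3 v))) := by
  obtain ⟨w₀, hw₀⟩ := F0P3cStCharTSVanDijkWeylSymm.exists_weylElt L v
  rcases eq_or_eq_weylConj_of_isConj_of_mem_cmTorus hns w₀ hw₀ hreg h with h1 | h1
  · rw [h1]
  · exact isConj_iff.2 ⟨w₀, h1.symm⟩

/-! ## §2 On the hyperbolic regular set, stable class = class, and `Φ^{st} = Φ` -/

variable {L v} in
/-- **A stable conjugate of a regular `t ∈ M` is `U(Φ₃)(L⁺_v)`-conjugate to `t`** (`v` non-split): part 1 (★ `exists_isConj_cmTorus_of_isStablyConjGAt`) conjugates it INTO `M`,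
§1 then fixes it up to the Weyl reflection. [cite: Rogawski1990, §3.6 pp. 28–31] -/
theorem isConj_of_isStablyConjGAt_of_mem_cmTorus (hns : ∀ w : PlacesOver L v, IsCMField.complexConj L • w.1 = w.1)
    {t : ↥(cmBorelTriple L 3 v).M} {γ' : Gqs L v}
    (hreg : IsRegularElt (((t : ↥(unitaryGroupOfForm (conjLocal L (IsCMField.complexConj L) v) (cmLocalForm L 3 v))) : Gqs L v).val :
      GL (Fin 3) (LocalRing L v)))
    (h : IsStablyConjGAt L (splitFormGL L) v ((t : ↥(unitaryGroupOfForm (conjLocal L (IsCMField.complexConj L) v) (cmLocalForm L 3 v))) : Gqs L v) γ') :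
    IsConj ((t : ↥(unitaryGroupOfForm (conjLocal L (IsCMField.complexConj L) v) (cmLocalForm L 3 v))) : Gqs L v) γ' := by
  obtain ⟨t', ht'reg, ht'⟩ := exists_isConj_cmTorus_of_isStablyConjGAt hns hreg h
  -- `t` and `t′` are conjugate in `GL₃` (both conjugate to `γ′` there)
  have hval : IsConj ((t' : ↥(unitaryGroupOfForm (conjLocal L (IsCMField.complexConj L) v) (cmLocalForm L 3 v))) : GL (Fin 3) (LocalRing L v))
      (γ'.val : GL (Fin 3) (LocalRing L v)) := by
    obtain ⟨c, hc⟩ := isConj_iff.mp ht'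
    exact isConj_iff.mpr ⟨(c.val : GL (Fin 3) (LocalRing L v)), by rw [← hc]; rfl⟩
  have htt' := isConj_of_isConj_val_of_mem_cmTorus hns (t := t) (t' := t') hreg (h.trans hval.symm)
  exact htt'.trans ht'

variable {L v} in
/-- **ON `M^{reg}`, STABLE CLASS = CLASS** (`v` non-split): for `t ∈ M` regular and any `γ′ ∈ U(Φ₃)(L⁺_v)`, `γ′` is stably conjugate to `t` iff it is conjugate to `t` —
`𝔇(M∕F) = 1`, the type-(0) Cartan of §3.6. [cite: Rogawski1990, §3.6 pp. 28–31; §3.1 p. 19] -/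
theorem isStablyConjGAt_iff_isConj_of_mem_cmTorus (hns : ∀ w : PlacesOver L v, IsCMField.complexConj L • w.1 = w.1)
    {t : ↥(cmBorelTriple L 3 v).M}
    (hreg : IsRegularElt (((t : ↥(unitaryGroupOfForm (conjLocal L (IsCMField.complexConj L) v) (cmLocalForm L 3 v))) : Gqs L v).val :
      GL (Fin 3) (LocalRing L v)))
    (γ' : Gqs L v) :
    IsStablyConjGAt L (splitFormGL L) v ((t : ↥(unitaryGroupOfForm (conjLocal L (IsCMField.complexConj L) v) (cmLocalForm L 3 v))) : Gqs L v) γ' ↔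
      IsConj ((t : ↥(unitaryGroupOfForm (conjLocal L (IsCMField.complexConj L) v) (cmLocalForm L 3 v))) : Gqs L v) γ' := by
  refine ⟨isConj_of_isStablyConjGAt_of_mem_cmTorus hns hreg, fun hc => ?_⟩
  obtain ⟨c, hc⟩ := isConj_iff.mp hc
  exact isConj_iff.mpr ⟨(c.val : GL (Fin 3) (LocalRing L v)), by rw [← hc]; rfl⟩

variable {L v} in
/-- **ON THE HYPERBOLIC REGULAR SET, STABLE CLASS = CLASS** (`v` non-split): for `γ ∈ Ω =` ★ `hyperbolicSet` (a conjugate of a regular element of `M`) and any `γ′`,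
`IsStablyConjGAt … γ γ′ ↔ IsConj γ γ′`. [cite: Rogawski1990, §3.6 pp. 28–31; §3.1 p. 19] -/
theorem isStablyConjGAt_iff_isConj_of_mem_hyperbolicSet (hns : ∀ w : PlacesOver L v, IsCMField.complexConj L • w.1 = w.1) {γ : Gqs L v}
    (hγ : γ ∈ F0P3cStCharTSTorusDefs.hyperbolicSet L v) (γ' : Gqs L v) :
    IsStablyConjGAt L (splitFormGL L) v γ γ' ↔ IsConj γ γ' := by
  obtain ⟨t, htreg, ht⟩ := hγ
  have htval : IsConj (((t : ↥(unitaryGroupOfForm (conjLocal L (IsCMField.complexConj L) v) (cmLocalForm L 3 v))) : Gqs L v).val : GL (Fin 3) (LocalRing L v))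
      (γ.val : GL (Fin 3) (LocalRing L v)) := by
    obtain ⟨c, hc⟩ := isConj_iff.mp ht
    exact isConj_iff.mpr ⟨(c.val : GL (Fin 3) (LocalRing L v)), by rw [← hc]; rfl⟩
  constructor
  · intro h
    -- `t ∼_{st} γ′` (through `γ`), hence `t ∼ γ′` in `G_v`, hence `γ ∼ γ′`
    exact ht.symm.trans (isConj_of_isStablyConjGAt_of_mem_cmTorus hns htreg (htval.trans h))
  · intro hc
    obtain ⟨c, hc⟩ := isConj_iff.mp hc
    exact isConj_iff.mpr ⟨(c.val : GL (Fin 3) (LocalRing L v)), by rw [← hc]; rfl⟩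

variable {L v} in
/-- **`Φ^{st}(γ, f) = Φ(γ, f)` ON THE HYPERBOLIC REGULAR SET** (`v` non-split): for `γ ∈ Ω` the stable orbital integral of FILE C's currency (★ `stableOrbitalIntegralRel` for
★ `IsStablyConjGAt` at the form of record: the `finsum` of the class orbital integrals over the conjugacy classes inside the stable class of `γ`) has the single term
`classOrbitalIntegral mG f ⟦γ⟧` — the stable class of `γ` is its class.  So the `M`-summand of the plain Weyl measure (★ `IsPlainWeylMeasure`, p. 182 first display) is already
in the shape of ★ `IsStableWeylMeasure` (p. 182 second display). [cite: Rogawski1990, §4.1 (4.1.1) p. 39; §12.5 p. 182; §3.6 pp. 28–31] -/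
theorem stableOrbitalIntegralRel_eq_classOrbitalIntegral_of_mem_hyperbolicSet (hns : ∀ w : PlacesOver L v, IsCMField.complexConj L • w.1 = w.1)
    [∀ γ₀ : Gqs L v, MeasurableSpace (Gqs L v ⧸ Subgroup.centralizer ({γ₀} : Set (Gqs L v)))]
    (mG : OrbitalMeasureFamily (Gqs L v)) (f : Gqs L v → ℂ) {γ : Gqs L v} (hγ : γ ∈ F0P3cStCharTSTorusDefs.hyperbolicSet L v) :
    stableOrbitalIntegralRel (IsStablyConjGAt L (splitFormGL L) v) mG f γ = classOrbitalIntegral mG f (ConjClasses.mk γ) := by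
  have hout : ∀ c : ConjClasses (Gqs L v), ConjClasses.mk (Quotient.out c) = c := fun c => by
    rw [← ConjClasses.quotient_mk_eq_mk, Quotient.out_eq]
  have hset : {c : ConjClasses (Gqs L v) | IsStablyConjGAt L (splitFormGL L) v γ (Quotient.out c)} = {ConjClasses.mk γ} := by
    ext c
    rw [Set.mem_setOf_eq, Set.mem_singleton_iff, isStablyConjGAt_iff_isConj_of_mem_hyperbolicSet hns hγ]
    exact ⟨fun hc => ((ConjClasses.mk_eq_mk_iff_isConj.2 hc).trans (hout c)).symm,
      fun h => ConjClasses.mk_eq_mk_iff_isConj.1 ((hout c).trans h).symm⟩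
  rw [stableOrbitalIntegralRel_def, hset, finsum_mem_singleton]

end NonSplit

end Summit.HodgeConjecture.HodgeConjecture.R90.S4

end
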